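import Summits.QuantumFields.YangMills.Theorems.WeakCouplingRatesRung

/-!
# Weak-coupling RATES below the Clay horizon — part 3/3: the clean-box split, its proved glue, and the rung nodes
# `XiDiv` (PROVED) / `XiPowSU2` / `XiPow` (OPEN leaves, D-0061)

Part 3 of the leaf module of cell `ym-beyond`, seat P3 «lower the summit honestly» (memo of record `run/shared/lean/pub/ym-beyond/ROUTE-P3.md`
v9 §12–§13); part 1 `WeakCouplingRatesCurrency` carries the full module description, honest framing and references; part 2
`WeakCouplingRatesRung` the proved rung XI-DIV.  Contents of this part (§5–§6 of the source, verbatim):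
* §5 The CLEAN-BOX SPLIT of PW-CORR-POLY (the route's typed cruxes): the cold-wall box state `boxState` (the tree's
  `ymSpecification` on the edges of `[0,2H]⁴` with flat boundary datum), `boxPlaqCov` / `torusPlaqCov`, and the named inputs
  `BoxTwoPointDomination`, `BulkDominatesBox`; the FLOOR input (`κ/n⁴ ≤ |c_n|` for the tree's `curvaturePlaquetteCorr 4 n`, the statement of
  stub F1 of `Cruxes/SofteningCentreBlind/Lines/birth.lean`) is written inline; glue PROVED: `polySeparationPlaquetteFloor_of_box`,
  `massGapPowerDecayOf_of_box`.
* §6 The rung NODES: `XiDiv` (XI-DIV for every compact simple `G` — PROVED, `xiDiv_holds`), and the LEAVES `XiPowSU2` (`∃ ε > 0`, every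
  torus-limit state of 4-D `SU(2)` Wilson theory has RP-spectral gap `≤ β^{-ε}` for `β ≥ β₀`) and `XiPow` (the same for every compact
  simple `G` and faithful unitary `r`), tagged `@[conjecture]` (OPEN; NOT claimed), with the proved glue
  `xiPowSU2_of_box : BOX → BULK → FLOOR → XiPowSU2` and `xiPowSU2_of_xiPow : XiPow → XiPowSU2`.
WHAT THIS IS NOT: not the Clay mass gap (`m > 0`), not confinement, not a continuum limit; the leaves are UPPER bounds on the lattice mass
gap (LOWER bounds on the correlation length), the trivial half of asymptotic scaling, registered as RUNG LEAVES (never summit credit).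
Reference for the `[cite:]` tags below: S. Chatterjee, *Yang–Mills for probabilists*, arXiv:1803.01950, Problem 5.1 [ChatterjeeYMProb2019].

FILING NOTE (courier). Filed for the cell by its courier seat (ym-beyond-courier g2) VERBATIM from `run/shared/lean/pub/ym-
beyond/LIFT-P3-WeakCouplingRates.lean` (sha16 d721fbe54c9c8af9, author P3 g9), re-partitioned into THREE tree modules because
Theorems files are capped at 400 lines (gate `lint.size`): `WeakCouplingRatesCurrency` = §1–§3, `WeakCouplingRatesRung` = §4,
`WeakCouplingRates` = §5–§6, import chain 1 → 2 → 3, ONE namespace `Summit.QuantumFields.YangMills.Theorems.WeakCouplingRates`,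
every declaration byte-identical and in source order.  Courier deltas, exhaustively: this note; the short module docstrings of parts
2–3; the re-opened `section` / `variable` preambles of parts 2–3 (copies of the source lines 65–80 and 180); three one-line
docstrings demanded by `lint.docstring` (on `timeShiftLG_zero`, `continuous_bounded_plaqCost0`,
`massGapPowerDecayOf_of_polySeparationFloor`).  No mathematics added, no statement changed.
-/

set_option autoImplicit false

noncomputable section

open MeasureTheory Filter Topology
open Literature.MathematicalPhysics
open Literature.MathematicalPhysics.QuantumFieldTheory
open Literature.MathematicalPhysics.QuantumLattice
open Summit.QuantumFields.YangMills.Theorems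

namespace Summit.QuantumFields.YangMills.Theorems.WeakCouplingRates

section Currency

variable {d N : ℕ} {G : Type*} [Group G] [TopologicalSpace G] [IsTopologicalGroup G] [CompactSpace G]
  [MeasurableSpace G] [BorelSpace G]

variable (ρ : G →* Matrix (Fin N) (Fin N) ℂ)

/-! ### §5. The CLEAN-BOX SPLIT of PW-CORR-POLY (the typed cruxes of the rates route) -/

/-- The torus-side connected two-point function of `UniformTorusPlaquetteCorr` at volume `(L+1)^d`, separation `T`, plane `(i, j)`
(`UniformTorusPlaquetteCorr d ρ i j T δ` is by definition `∃ β₀, ∀ β ≥ β₀, ∀ᶠ L, δ β ≤ torusPlaqCov ρ β L (T β) i j`). -/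
def torusPlaqCov (β : ℝ) (L T : ℕ) (i j : Fin d) [NeZero d] : ℝ :=
  wilsonExpectation (L := L + 1) ρ β
      (toTorusObservable (L + 1) fun U => plaqCost0 ρ i j U * plaqCost0 ρ i j (timeShiftLG (G := G) T U)) -
    wilsonExpectation (L := L + 1) ρ β (toTorusObservable (L + 1) (plaqCost0 ρ i j)) *
      wilsonExpectation (L := L + 1) ρ β
        (toTorusObservable (L + 1) fun U => plaqCost0 ρ i j (timeShiftLG (G := G) T U))

/-- The plaquette cost `N − Re tr ρ(U_p)` of the plaquette based at the site `x` in the `(i, j)` plane. -/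
def plaqCostAt (x : Literature.Probability.LatticeModels.Site d) (i j : Fin d) : LGConfig d G → ℝ :=
  fun U => (N : ℝ) - plaquetteObs ρ x i j U

/-- **The cold-wall box state** on `ℤ⁴`: the tree's lattice Yang–Mills specification kernel `ymSpecification ρ β Λ η` on the edge set
`Λ = AxialGauge.boxEdges 4 (2H+1)` (all links of the cube `[0, 2H]⁴`) with the FLAT boundary datum `η ≡ 1` (every link outside the cube
is the identity: a Dirichlet / cold wall).  Centre site `(H, H, H, H)`. -/
def boxState (β : ℝ) (H : ℕ) : Measure (LGConfig 4 G) :=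
  ymSpecification (d := 4) ρ β (AxialGauge.boxEdges 4 (2 * H + 1)) (fun _ => 1)

/-- The centre of the box `[0, 2H]⁴`. -/
def boxCentre (H : ℕ) : Literature.Probability.LatticeModels.Site 4 := fun _ => (H : ℤ)

/-- The connected two-point function, in the cold-wall box of half-side `H`, of the costs of the `(1,2)`-plaquette at the centre and of its
translate by `T e₀`. -/
def boxPlaqCov (β : ℝ) (H T : ℕ) : ℝ :=
  (∫ U, plaqCostAt ρ (boxCentre H) 1 2 U * plaqCostAt ρ (boxCentre H + Pi.single 0 (T : ℤ)) 1 2 U ∂(boxState ρ β H)) -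
    (∫ U, plaqCostAt ρ (boxCentre H) 1 2 U ∂(boxState ρ β H)) *
      (∫ U, plaqCostAt ρ (boxCentre H + Pi.single 0 (T : ℤ)) 1 2 U ∂(boxState ρ β H))

/-- **Crux BOX — Gaussian domination of the two-plaquette covariance in a cold box** (exponents `A < θ`, constant `c > 0`): for `β ≥ β₀`,
`β² · Cov_{box ⌈β^θ⌉}(c_p, c_{p + ⌈β^A⌉ e₀}) ≥ c · c_{⌈β^A⌉}²`, where `c_n = curvaturePlaquetteCorr 4 n` is the lattice-Maxwell field-strength
two-point number (free two-gluon exchange gives `β² Cov → (dim G / 2)·Π_box² ≈ (dim G/2) c_n²`).  The single-scale, finite-volume half of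
PW-CORR-POLY: a cold box of polynomial size pins the gauge and makes large fields rare by a union bound (for small `θ`); what remains is
second-order perturbation theory with error `o(c_n²) = o(β^{-8A})` relative precision.  NOT in print (leading-order free energy only:
Chatterjee 2016 §§9–13).  NOT THE CLAY GAP. -/
def BoxTwoPointDomination (A θ c : ℝ) : Prop :=
  ∃ β₀ : ℝ, ∀ β : ℝ, β₀ ≤ β →
    c * curvaturePlaquetteCorr (d := 4) (by norm_num) (⌈β ^ A⌉₊ : ℤ) ^ 2 ≤
      β ^ 2 * boxPlaqCov ρ β ⌈β ^ θ⌉₊ ⌈β ^ A⌉₊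

/-- **Crux BULK — the torus states dominate a fixed fraction of the cold-box covariance, uniformly in the volume** (exponents `A < θ`):
there is `η > 0` such that for `β ≥ β₀` and all large tori, `Cov_{torus L}(c_p, c_{p + ⌈β^A⌉e₀}) ≥ η · Cov_{box ⌈β^θ⌉}(same pair)`.  This is the
INFINITE-VOLUME content of PW-CORR-POLY (sub-horizon large fields are rare in every volume; the bulk state is locally the cold-box state to
relative precision `o(1)` on a signal of size `β^{-2-8A}`): renormalisation-group class (Bałaban's large-field renormalisation, CMP 122
(1989)), or a new idea.  No correlation inequality is available for non-abelian `G`.  NOT in print.  NOT THE CLAY GAP. -/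
def BulkDominatesBox (A θ : ℝ) : Prop :=
  ∃ η : ℝ, 0 < η ∧ ∃ β₀ : ℝ, ∀ β : ℝ, β₀ ≤ β → ∀ᶠ L : ℕ in atTop,
    η * boxPlaqCov ρ β ⌈β ^ θ⌉₊ ⌈β ^ A⌉₊ ≤ torusPlaqCov (d := 4) ρ β L ⌈β ^ A⌉₊ 1 2

end Currency

/-! The FLOOR input of the glue below — `∃ κ > 0, ∃ n₀, ∀ n ≥ n₀, κ / n⁴ ≤ |curvaturePlaquetteCorr 4 n|` (power-law floor of the
lattice Maxwell curvature two-point number `c_n = −(Δ₁+Δ₂)G₀(n e₀)`, continuum value `1/(π² n⁴)`; second-difference asymptotics of the lattice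
Green function, Lawler 1991 Thm 1.5.5 / Lawler–Limic 2010 §4.3) — is written INLINE: it is the statement of stub F1 `stub_curvatureCorrFloor`
of `Cruxes/SofteningCentreBlind/Lines/birth.lean` (route `ThermalRuler`) and the support item `CurvatureCorrPowerFloor` of the rates route, so
one proof serves all three. -/

section Glue

variable {N : ℕ} {G : Type*} [Group G] [TopologicalSpace G] [IsTopologicalGroup G] [CompactSpace G]
  [MeasurableSpace G] [BorelSpace G] (ρ : G →* Matrix (Fin N) (Fin N) ℂ)

/-- Arithmetic of the split: for `β ≥ 1`, `T = ⌈β^A⌉₊` satisfies `1 ≤ T ≤ 2 β^A`. -/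
theorem one_le_ceil_rpow_and_le {β A : ℝ} (hβ : 1 ≤ β) (hA : 0 ≤ A) :
    (1 : ℝ) ≤ (⌈β ^ A⌉₊ : ℝ) ∧ (⌈β ^ A⌉₊ : ℝ) ≤ 2 * β ^ A := by
  have h1 : (1 : ℝ) ≤ β ^ A := Real.one_le_rpow hβ hA
  refine ⟨h1.trans (Nat.le_ceil _), ?_⟩
  have := Nat.ceil_lt_add_one (zero_le_one.trans h1)
  linarith

/-- **GLUE (proved): BOX ∧ BULK ∧ FLOOR ⇒ PW-CORR-POLY(A, κ') for some `κ' > 0`.** -/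
theorem polySeparationPlaquetteFloor_of_box {A θ c : ℝ} (hA : 0 < A) (hc : 0 < c)
    (hbox : BoxTwoPointDomination ρ A θ c) (hbulk : BulkDominatesBox ρ A θ)
    (hF : ∃ κ : ℝ, 0 < κ ∧ ∃ n₀ : ℕ, ∀ n : ℕ, n₀ ≤ n → κ / (n : ℝ) ^ 4 ≤ |Literature.MathematicalPhysics.QuantumFieldTheory.curvaturePlaquetteCorr (d := 4) (by norm_num) (n : ℤ)|) :
    ∃ κ : ℝ, 0 < κ ∧ PolySeparationPlaquetteFloor 4 ρ 1 2 A κ := by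
  obtain ⟨β₁, hbox⟩ := hbox
  obtain ⟨η, hη, β₂, hbulk⟩ := hbulk
  obtain ⟨κ, hκ, n₀, hF⟩ := hF
  refine ⟨η * c * κ ^ 2 / 256, by positivity, ?_⟩
  -- thresholds: `β ≥ 1`, the two crux thresholds, and `⌈β^A⌉₊ ≥ n₀`
  have hTinf : ∀ᶠ β : ℝ in atTop, (n₀ : ℝ) ≤ (⌈β ^ A⌉₊ : ℝ) := by
    filter_upwards [(tendsto_rpow_atTop hA).eventually_ge_atTop (n₀ : ℝ)] with β hβ
    exact hβ.trans (Nat.le_ceil _)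
  obtain ⟨β₃, hβ₃⟩ := eventually_atTop.1 hTinf
  refine ⟨max (max β₁ β₂) (max β₃ 1), fun β hβ => ?_⟩
  have hβ1 : β₁ ≤ β := (le_max_left _ _).trans ((le_max_left _ _).trans hβ)
  have hβ2 : β₂ ≤ β := (le_max_right _ _).trans ((le_max_left _ _).trans hβ)
  have hβ3 : β₃ ≤ β := (le_max_left _ _).trans ((le_max_right _ _).trans hβ)
  have hβone : (1 : ℝ) ≤ β := (le_max_right _ _).trans ((le_max_right _ _).trans hβ)
  have hβ0 : 0 < β := one_pos.trans_le hβone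
  filter_upwards [hbulk β hβ2] with L hL
  set T : ℕ := ⌈β ^ A⌉₊ with hTdef
  obtain ⟨hT1, hT2⟩ := one_le_ceil_rpow_and_le (A := A) hβone hA.le
  have hT0 : (0 : ℝ) < (T : ℝ) := one_pos.trans_le hT1
  have hn₀T : n₀ ≤ T := by exact_mod_cast hβ₃ β hβ3
  -- FLOOR at `T`
  have hcT : κ ^ 2 / (T : ℝ) ^ 8 ≤ curvaturePlaquetteCorr (d := 4) (by norm_num) (T : ℤ) ^ 2 := by
    have h := hF T hn₀T
    have hk0 : 0 ≤ κ / (T : ℝ) ^ 4 := by positivity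
    have := mul_self_le_mul_self hk0 h
    rw [← sq, ← sq, sq_abs, div_pow] at this
    calc κ ^ 2 / (T : ℝ) ^ 8 = κ ^ 2 / ((T : ℝ) ^ 4) ^ 2 := by ring
      _ ≤ _ := this
  -- BOX at `β`
  have hB := hbox β hβ1
  have hbox' : c * (κ ^ 2 / (T : ℝ) ^ 8) / β ^ 2 ≤ boxPlaqCov ρ β ⌈β ^ θ⌉₊ T := by
    rw [div_le_iff₀ (by positivity)]
    calc c * (κ ^ 2 / (T : ℝ) ^ 8) ≤ c * curvaturePlaquetteCorr (d := 4) (by norm_num) (T : ℤ) ^ 2 :=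
          mul_le_mul_of_nonneg_left hcT hc.le
      _ ≤ β ^ 2 * boxPlaqCov ρ β ⌈β ^ θ⌉₊ T := hB
      _ = boxPlaqCov ρ β ⌈β ^ θ⌉₊ T * β ^ 2 := mul_comm _ _
  -- BULK at `(β, L)`
  have hchain : η * (c * (κ ^ 2 / (T : ℝ) ^ 8) / β ^ 2) ≤ torusPlaqCov ρ β L T 1 2 :=
    (mul_le_mul_of_nonneg_left hbox' hη.le).trans hL
  -- `T^8 ≤ 256 (β^A)^8` and `β^{-(2+8A)} = (β^2 (β^A)^8)⁻¹`
  have hβA : 0 < β ^ A := Real.rpow_pos_of_pos hβ0 A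
  have hT8 : (T : ℝ) ^ 8 ≤ 256 * (β ^ A) ^ 8 := by
    have := pow_le_pow_left₀ hT0.le hT2 8
    calc (T : ℝ) ^ 8 ≤ (2 * β ^ A) ^ 8 := this
      _ = 256 * (β ^ A) ^ 8 := by ring
  have hrpow : β ^ (-(2 + 8 * A)) = (β ^ 2 * (β ^ A) ^ 8)⁻¹ := by
    rw [Real.rpow_neg hβ0.le, Real.rpow_add hβ0, Real.rpow_two]
    congr 2
    rw [show (8 : ℝ) * A = A * (8 : ℕ) by push_cast; ring, Real.rpow_mul_natCast hβ0.le]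
  show η * c * κ ^ 2 / 256 * β ^ (-(2 + 8 * A)) ≤ torusPlaqCov ρ β L T 1 2
  rw [hrpow]
  refine le_trans ?_ hchain
  have hpos1 : 0 < β ^ 2 * (β ^ A) ^ 8 := by positivity
  rw [show η * (c * (κ ^ 2 / (T : ℝ) ^ 8) / β ^ 2) = η * c * κ ^ 2 / ((T : ℝ) ^ 8 * β ^ 2) by
    field_simp]
  rw [show η * c * κ ^ 2 / 256 * (β ^ 2 * (β ^ A) ^ 8)⁻¹ = η * c * κ ^ 2 / (256 * (β ^ A) ^ 8 * β ^ 2) by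
    field_simp]
  exact div_le_div_of_nonneg_left (by positivity) (by positivity)
    (mul_le_mul_of_nonneg_right hT8 (by positivity))

/-- **GLUE (proved): BOX ∧ BULK ∧ FLOOR ⇒ XI-POW(A/2)** for the model `ρ` (continuous). -/
theorem massGapPowerDecayOf_of_box (hρ : Continuous ρ) {A θ c : ℝ} (hA : 0 < A) (hc : 0 < c)
    (hbox : BoxTwoPointDomination ρ A θ c) (hbulk : BulkDominatesBox ρ A θ)
    (hF : ∃ κ : ℝ, 0 < κ ∧ ∃ n₀ : ℕ, ∀ n : ℕ, n₀ ≤ n → κ / (n : ℝ) ^ 4 ≤ |Literature.MathematicalPhysics.QuantumFieldTheory.curvaturePlaquetteCorr (d := 4) (by norm_num) (n : ℤ)|) :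
    MassGapPowerDecayOf 4 ρ (A / 2) := by
  obtain ⟨κ, hκ, h⟩ := polySeparationPlaquetteFloor_of_box ρ hA hc hbox hbulk hF
  exact massGapPowerDecayOf_of_polySeparationFloor ρ hρ (by decide) (by decide) hA hκ h

end Glue

/-! ### §6. The rung nodes (D-0061): XI-DIV (PROVED) and the leaves XI-POW for `SU(2)` / for every compact simple `G` (OPEN) -/

/-- **Rung node `XiDiv` — «the correlation length diverges as `β → ∞`», for EVERY compact simple `G` (`d = 4`), PROVED** (`xiDiv_holds`
below = `massGapVanishesOf_allSimpleG`): for every `ε > 0` and all large `β`, no infinite-volume torus-limit state of the Wilson theory with a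
faithful unitary lattice representation `r` has an RP-spectral (transfer-matrix) mass gap larger than `ε`.  The qualitative half of the rates
axis; cf. the second half of Chatterjee's Problem 5.1 («prove that `ξ(β) → ∞`»), here in RP-spectral form for torus-limit states.  Stated as a
named node so that the ladder can cite the proved rung by FQN.  NOT THE CLAY GAP (an UPPER bound on the gap).
[cite: ChatterjeeYMProb2019, Problem 5.1 (second half)] -/
@[conjecture] def XiDiv : Prop :=
  ∀ (G : Type) [Group G] [TopologicalSpace G] [IsTopologicalGroup G] [CompactSpace G],
    IsCompactSimpleLieGroup G →
    letI : MeasurableSpace G := borel G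
    haveI : BorelSpace G := ⟨rfl⟩
    ∀ r : LatticeRep G, MassGapVanishesOf 4 r.ρ

/-- `XiDiv` holds (the proved rung `massGapVanishesOf_allSimpleG`). -/
theorem xiDiv_holds : XiDiv := massGapVanishesOf_allSimpleG

/-- **LEAF `XiPowSU2` (rung «R1-rates» of LADDER-YM; P3's infinite-volume target of record XI-POW(ε₀)).**  There is `ε > 0` such that for all
`β ≥ β₀` every infinite-volume torus-limit state of four-dimensional `SU(2)` lattice Yang–Mills theory (Wilson action, fundamental
representation) has RP-spectral mass gap at most `β^{-ε}` in lattice units — the correlation length grows at least like a power of `β`.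
OPEN: a power RATE in the second half of Chatterjee's Problem 5.1 (which asks only `ξ(β) → ∞`; that half, in this currency, is `XiDiv`,
proved); no rate is in print for any four-dimensional non-abelian theory.  NOT THE CLAY GAP: an UPPER bound on the gap; true (vacuously) in a
massless phase. [cite: ChatterjeeYMProb2019, Problem 5.1 (second half; power-rate form not in print)] [status: open] -/
@[conjecture] def XiPowSU2 : Prop :=
  ∃ ε : ℝ, 0 < ε ∧
    MassGapPowerDecayOf 4 (G := Matrix.specialUnitaryGroup (Fin 2) ℂ) (fundamentalRep (Fin 2)) ε

/-- **LEAF `XiPow` (all compact simple `G`).**  For every compact simple `G` and faithful unitary lattice representation `r` there is `ε > 0`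
such that for `β ≥ β₀` every torus-limit state of the 4-D Wilson theory has RP-spectral mass gap `≤ β^{-ε}`.  OPEN (implies `XiPowSU2`:
`xiPowSU2_of_xiPow`).  NOT THE CLAY GAP. [cite: ChatterjeeYMProb2019, Problem 5.1 (second half; power-rate form not in print)] [status: open] -/
@[conjecture] def XiPow : Prop :=
  ∀ (G : Type) [Group G] [TopologicalSpace G] [IsTopologicalGroup G] [CompactSpace G],
    IsCompactSimpleLieGroup G →
    letI : MeasurableSpace G := borel G
    haveI : BorelSpace G := ⟨rfl⟩
    ∀ r : LatticeRep G, ∃ ε : ℝ, 0 < ε ∧ MassGapPowerDecayOf 4 r.ρ ε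

/-- **The deciding glue of the rates route, proved:** BOX ∧ BULK ∧ FLOOR for `SU(2)` (any admissible exponents `0 < A`, `θ`, constant
`c > 0`) ⇒ `XiPowSU2` with `ε = A/2`. -/
theorem xiPowSU2_of_box {A θ c : ℝ} (hA : 0 < A) (hc : 0 < c)
    (hbox : BoxTwoPointDomination (G := Matrix.specialUnitaryGroup (Fin 2) ℂ) (fundamentalRep (Fin 2)) A θ c)
    (hbulk : BulkDominatesBox (G := Matrix.specialUnitaryGroup (Fin 2) ℂ) (fundamentalRep (Fin 2)) A θ)
    (hF : ∃ κ : ℝ, 0 < κ ∧ ∃ n₀ : ℕ, ∀ n : ℕ, n₀ ≤ n → κ / (n : ℝ) ^ 4 ≤ |Literature.MathematicalPhysics.QuantumFieldTheory.curvaturePlaquetteCorr (d := 4) (by norm_num) (n : ℤ)|) :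
    XiPowSU2 :=
  ⟨A / 2, by linarith, massGapPowerDecayOf_of_box _ (continuous_fundamentalRep (Fin 2)) hA hc hbox hbulk hF⟩

/-- The all-`G` leaf implies the `SU(2)` leaf (`SU(2)` is compact simple: tree `isCompactSimpleLieGroup_specialUnitaryGroup` ∘
`isSimpleCompactGroup_specialUnitaryGroup_holds`; its fundamental representation is the `LatticeRep` `fundamentalLatticeRep 2`). -/
theorem xiPowSU2_of_xiPow (h : XiPow) : XiPowSU2 := by
  obtain ⟨ε, hε, hP⟩ := h (Matrix.specialUnitaryGroup (Fin 2) ℂ)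
    (isCompactSimpleLieGroup_specialUnitaryGroup isSimpleCompactGroup_specialUnitaryGroup_holds le_rfl)
    (fundamentalLatticeRep 2)
  exact ⟨ε, hε, hP⟩

/-- Non-vacuity pointer: torus-limit states exist at every coupling (tree `infiniteVolumeLimitPoints_nonempty_holds`), so the leaves quantify
over a non-empty family of states. -/
example : Prop := infiniteVolumeLimitPoints_nonempty (d := 4) (G := Matrix.specialUnitaryGroup (Fin 2) ℂ) (fundamentalRep (Fin 2))

end Summit.QuantumFields.YangMills.Theorems.WeakCouplingRates

end
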